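import Mathlib

/-!
# Route BarrierLever — Chow witnesses for partition minors (item 20172, CPM): the STAR LEMMA and the
# structural classification of LOCKED layout pairs of height `4` and size `5` (decide-free)

Helper file (`--supports stmt-ValiantsHypothesis-20172`; cell valiant-natproofs, rung V4, 𝒟-side of
door (c); seat valiant-natproofs-prover gen 12, at the request of val-np-p4 gen 12, whose size-`≤ 5`
slice of CPM — `chowHits_of_size_le_five`, via the bounded core engine `chow_hit_of_core` and the
certified table of `…ChowCertifiedTables` — consumes the classification below).  Closes NO item.
Mathlib only; every statement is about families of finite sets, no polynomial appears.

Conventions (items 19717 / 20172 / 20195, files `…ChowLockedCoreEngine`, `…ChowCoreEngine`): a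
layout side is `u : Fin r → Finset (Fin m)` (injective = `r` distinct subsets of `Fin m`); the DEGREE
of a coordinate `a` is `#{i | a ∈ u i}`, written `(Finset.univ.filter fun i => a ∈ u i).card`; a
pair `(u, w)` is LOCKED when no literal class `{i | (a ∈ u i) = β}` of the rows has the size of a
literal class `{j | (c ∈ w j) = γ}` of the columns.

* `exists_degree_strict` — `r ≥ 2` distinct sets have a coordinate of degree strictly between `0`
  and `r` (two distinct sets are separated by a coordinate).
* `card_le_sum_card_add_one_of_injective` — distinct sets indexed by `S` have total size
  `≥ #S - 1` (at most one of them is empty).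
* `sum_card_filter_mem_eq_sum_card` — double counting `∑_a #{j | a ∈ v j} = ∑_j #(v j)`.
* `exists_center_of_degrees` — **THE STAR LEMMA, every `m`**: `r ≥ m + 1` distinct subsets of
  `Fin m` all of whose coordinate degrees `d` satisfy `d ≤ 1 ∨ d ≥ r - 1` lie in a Hamming ball of
  radius `1`: `∃ B, ∀ j, #(u j ∆ B) ≤ 1`.  Proof: with `B = {a | 2 ≤ deg a}` every coordinate lies in
  at most one of the sets `u j ∆ B`, so `∑_j #(u j ∆ B) ≤ m`; but `r` distinct sets have total size
  `≥ r - 1 ≥ m`, and a member of size `≥ 2` would push the total to `≥ r > m`.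
* `exists_index_eq_of_star`, `card_eq_of_star` — such a family is the WHOLE ball: every `S` with
  `#(S ∆ B) ≤ 1` is some `u j`, and `r = m + 1`.
* `degree_ne_and_add_ne_of_locked` — in a locked pair no row degree equals a column degree or its
  complement to `r`.
* `locked_star_classification` — **height `4`, size `5`**: a locked injective pair `(u, w)` of
  subsets of `Fin 4` indexed by `Fin 5` has EITHER all row degrees outside `{1, 4}` and star columns,
  OR all column degrees outside `{1, 4}` and star rows.  (Degree logic: a column degree in `{1, 4}`
  forces all row degrees into `{0, 2, 3, 5}`, then a strict row degree is `2` or `3` and forces all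
  column degrees into `{0, 1, 4, 5}` = star; a column degree in `{2, 3}` is the mirror case.)  This
  replaces the two `C(16, 5)`-family decides of the size-`5` plan by a proof.

WHAT THIS IS NOT: no Chow witness and no certificate — the `95 × 16` determinant table and the
`S₄`-normal forms of the degree class stay with val-np-p4's size-`≤ 5` file; nothing on items 20172 /
20195 / 19717 themselves, on crux stmt-ValiantsHypothesis-14610, or on `VP` versus `VNP`.
-/

set_option linter.dupNamespace false

namespace Summit.ValiantsHypothesis.ValiantsHypothesis.Theorems.BarrierLever.ChowFactor

open Finset

/-! ## 1. Degrees -/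

/-- A coordinate lying in some member has positive degree. -/
theorem degree_pos_of_mem {m r : ℕ} (u : Fin r → Finset (Fin m)) {a : Fin m} {i : Fin r}
    (hi : a ∈ u i) : 0 < (Finset.univ.filter fun i => a ∈ u i).card :=
  Finset.card_pos.mpr ⟨i, by simpa using hi⟩

/-- A coordinate missing from some member has degree `< r`. -/
theorem degree_lt_of_not_mem {m r : ℕ} (u : Fin r → Finset (Fin m)) {a : Fin m} {i : Fin r}
    (hi : a ∉ u i) : (Finset.univ.filter fun i => a ∈ u i).card < r := by
  have h : (Finset.univ.filter fun i => a ∈ u i) ⊂ Finset.univ :=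
    Finset.filter_ssubset.mpr ⟨i, Finset.mem_univ _, hi⟩
  simpa using Finset.card_lt_card h

/-- The degree and the co-degree of a coordinate add up to `r`. -/
theorem degree_add_codegree {m r : ℕ} (u : Fin r → Finset (Fin m)) (a : Fin m) :
    (Finset.univ.filter fun i => a ∈ u i).card + (Finset.univ.filter fun i => a ∉ u i).card = r := by
  have e := Finset.card_filter_add_card_filter_not (s := (Finset.univ : Finset (Fin r)))
    (fun i => a ∈ u i)
  simpa using e

/-- **Two distinct sets are separated by a coordinate**: an injective family of `r ≥ 2` subsets of
`Fin m` has a coordinate whose degree is neither `0` nor `r`. -/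
theorem exists_degree_strict {m r : ℕ} (u : Fin r → Finset (Fin m)) (hu : Function.Injective u)
    (hr : 2 ≤ r) :
    ∃ a : Fin m, 0 < (Finset.univ.filter fun i => a ∈ u i).card ∧
      (Finset.univ.filter fun i => a ∈ u i).card < r := by
  have hne : u ⟨0, by omega⟩ ≠ u ⟨1, by omega⟩ := fun h => by
    have := hu h
    simp [Fin.ext_iff] at this
  obtain ⟨a, ha⟩ : ∃ a, ¬ (a ∈ u ⟨0, by omega⟩ ↔ a ∈ u ⟨1, by omega⟩) := by
    by_contra hall
    push Not at hall
    exact hne (Finset.ext hall)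
  by_cases h0 : a ∈ u ⟨0, by omega⟩
  · have h1 : a ∉ u ⟨1, by omega⟩ := fun h1 => ha ⟨fun _ => h1, fun _ => h0⟩
    exact ⟨a, degree_pos_of_mem u h0, degree_lt_of_not_mem u h1⟩
  · have h1 : a ∈ u ⟨1, by omega⟩ := by
      by_contra h1
      exact ha ⟨fun h => absurd h h0, fun h => absurd h h1⟩
    exact ⟨a, degree_pos_of_mem u h1, degree_lt_of_not_mem u h0⟩

/-! ## 2. Counting -/

/-- **At most one of distinct sets is empty**: for `v` injective on `S`,
`#S ≤ ∑_{j ∈ S} #(v j) + 1`. -/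
theorem card_le_sum_card_add_one_of_injective {ι α : Type*} (S : Finset ι) (v : ι → Finset α)
    (hv : Set.InjOn v S) : S.card ≤ ∑ j ∈ S, (v j).card + 1 := by
  classical
  have hsplit := Finset.card_filter_add_card_filter_not (s := S) (fun j => v j = ∅)
  have hempty : (S.filter fun j => v j = ∅).card ≤ 1 := by
    refine Finset.card_le_one.mpr fun j hj j' hj' => ?_
    rw [Finset.mem_filter] at hj hj'
    exact hv hj.1 hj'.1 (hj.2.trans hj'.2.symm)
  have hfull : (S.filter fun j => ¬ v j = ∅).card ≤ ∑ j ∈ S, (v j).card := by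
    calc (S.filter fun j => ¬ v j = ∅).card = ∑ j ∈ S.filter (fun j => ¬ v j = ∅), 1 :=
          Finset.card_eq_sum_ones _
      _ ≤ ∑ j ∈ S.filter (fun j => ¬ v j = ∅), (v j).card := by
          refine Finset.sum_le_sum fun j hj => ?_
          rw [Finset.mem_filter] at hj
          exact Finset.one_le_card.mpr (Finset.nonempty_iff_ne_empty.mpr hj.2)
      _ ≤ ∑ j ∈ S, (v j).card :=
          Finset.sum_le_sum_of_subset_of_nonneg (Finset.filter_subset _ _) fun _ _ _ => Nat.zero_le _
  omega

/-- **Double counting** of the incidences between coordinates and members: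
`∑_a #{j | a ∈ v j} = ∑_j #(v j)`. -/
theorem sum_card_filter_mem_eq_sum_card {m r : ℕ} (v : Fin r → Finset (Fin m)) :
    ∑ a : Fin m, (Finset.univ.filter fun j => a ∈ v j).card = ∑ j : Fin r, (v j).card := by
  have h1 : ∀ a : Fin m, (Finset.univ.filter fun j => a ∈ v j).card =
      ∑ j : Fin r, if a ∈ v j then 1 else 0 := fun a => Finset.card_filter _ _
  have h2 : ∀ j : Fin r, (v j).card = ∑ a : Fin m, if a ∈ v j then 1 else 0 := fun j => by
    rw [← Finset.card_filter, Finset.filter_mem_eq_inter, Finset.univ_inter]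
  simp_rw [h1, h2]
  exact Finset.sum_comm

/-! ## 3. The star lemma -/

/-- **STAR LEMMA (every `m`).**  If `u` lists `r ≥ m + 1` distinct subsets of `Fin m` and every
coordinate degree `d` satisfies `d ≤ 1 ∨ r ≤ d + 1`, then the family lies in a Hamming ball of
radius one: there is a centre `B` with `#(u j ∆ B) ≤ 1` for every `j`. -/
theorem exists_center_of_degrees {m r : ℕ} (u : Fin r → Finset (Fin m)) (hu : Function.Injective u)
    (hr : m + 1 ≤ r)
    (hdeg : ∀ a : Fin m, (Finset.univ.filter fun i => a ∈ u i).card ≤ 1 ∨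
      r ≤ (Finset.univ.filter fun i => a ∈ u i).card + 1) :
    ∃ B : Finset (Fin m), ∀ j, (symmDiff (u j) B).card ≤ 1 := by
  classical
  -- the centre: coordinates of large degree
  set B : Finset (Fin m) := Finset.univ.filter fun a => 2 ≤ (Finset.univ.filter fun i => a ∈ u i).card
    with hB
  refine ⟨B, ?_⟩
  set v : Fin r → Finset (Fin m) := fun j => symmDiff (u j) B with hv
  -- every coordinate lies in at most one `v j`
  have hcoord : ∀ a : Fin m, (Finset.univ.filter fun j => a ∈ v j).card ≤ 1 := by
    intro a
    rcases hdeg a with hsmall | hlarge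
    · -- small degree: `a ∉ B`, so `a ∈ v j ↔ a ∈ u j`
      have haB : a ∉ B := by
        rw [hB, Finset.mem_filter]
        omega
      have : (Finset.univ.filter fun j => a ∈ v j) = Finset.univ.filter fun j => a ∈ u j := by
        refine Finset.filter_congr fun j _ => ?_
        rw [hv, Finset.mem_symmDiff]
        tauto
      rw [this]
      exact hsmall
    · by_cases hsmall : (Finset.univ.filter fun i => a ∈ u i).card ≤ 1
      · -- (then `r ≤ 2`, and the small case applies verbatim)
        have haB : a ∉ B := by
          rw [hB, Finset.mem_filter]
          omega
        have : (Finset.univ.filter fun j => a ∈ v j) = Finset.univ.filter fun j => a ∈ u j := by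
          refine Finset.filter_congr fun j _ => ?_
          rw [hv, Finset.mem_symmDiff]
          tauto
        rw [this]
        exact hsmall
      · -- large degree: `a ∈ B`, so `a ∈ v j ↔ a ∉ u j`, and the co-degree is `≤ 1`
        have haB : a ∈ B := by
          rw [hB, Finset.mem_filter]
          exact ⟨Finset.mem_univ _, by omega⟩
        have : (Finset.univ.filter fun j => a ∈ v j) = Finset.univ.filter fun j => a ∉ u j := by
          refine Finset.filter_congr fun j _ => ?_
          rw [hv, Finset.mem_symmDiff]
          tauto
        rw [this]
        have := degree_add_codegree u a
        omega
  -- hence the total size of the `v j` is at most `m`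
  have htotal : ∑ j : Fin r, (v j).card ≤ m := by
    rw [← sum_card_filter_mem_eq_sum_card v]
    calc ∑ a : Fin m, (Finset.univ.filter fun j => a ∈ v j).card ≤ ∑ _a : Fin m, 1 :=
          Finset.sum_le_sum fun a _ => hcoord a
      _ = m := by simp
  -- the `v j` are distinct; a member of size `≥ 2` would make the total `≥ r > m`
  have hvinj : Function.Injective v := fun j j' hjj => hu (symmDiff_left_injective B hjj)
  intro j₀
  by_contra hbig
  push Not at hbig
  have hrest := card_le_sum_card_add_one_of_injective (Finset.univ.erase j₀) v
    (hvinj.injOn.mono (Set.subset_univ _))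
  have hsplit := Finset.add_sum_erase (Finset.univ : Finset (Fin r)) (fun j => (v j).card)
    (Finset.mem_univ j₀)
  rw [Finset.card_erase_of_mem (Finset.mem_univ _), Finset.card_univ, Fintype.card_fin] at hrest
  have hv0 : (v j₀).card = (symmDiff (u j₀) B).card := rfl
  omega

/-! ## 4. A star family of `m + 1` members is the whole ball -/

/-- A set at symmetric-difference distance `≤ 1` from `B` is `B` or some `B ∆ {a}`. -/
theorem eq_or_eq_symmDiff_singleton_of_card_le_one {m : ℕ} (B S : Finset (Fin m))
    (hS : (symmDiff S B).card ≤ 1) : S = B ∨ ∃ a : Fin m, S = symmDiff B {a} := by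
  rcases Nat.le_one_iff_eq_zero_or_eq_one.mp hS with h0 | h1
  · left
    have h0' : symmDiff S B = ∅ := Finset.card_eq_zero.mp h0
    rwa [← Finset.bot_eq_empty, symmDiff_eq_bot] at h0'
  · right
    obtain ⟨a, ha⟩ := Finset.card_eq_one.mp h1
    refine ⟨a, ?_⟩
    rw [← symmDiff_symmDiff_cancel_right B S, ha, symmDiff_comm]

/-- The Hamming ball of radius one around `B`, as a finset of `≤ m + 1` sets. -/
theorem card_ball_le (m : ℕ) (B : Finset (Fin m)) :
    (insert B (Finset.univ.image fun a : Fin m => symmDiff B {a})).card ≤ m + 1 := by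
  refine (Finset.card_insert_le _ _).trans ?_
  have := Finset.card_image_le (s := (Finset.univ : Finset (Fin m))) (f := fun a : Fin m => symmDiff B {a})
  rw [Finset.card_univ, Fintype.card_fin] at this
  omega

/-- **A star family with `≥ m + 1` members exhausts the ball**: if `u` lists `r ≥ m + 1` distinct
subsets of `Fin m` all at distance `≤ 1` from `B`, then every set at distance `≤ 1` from `B` is a
member. -/
theorem exists_index_eq_of_star {m r : ℕ} (u : Fin r → Finset (Fin m)) (hu : Function.Injective u)
    (hr : m + 1 ≤ r) (B : Finset (Fin m)) (hstar : ∀ j, (symmDiff (u j) B).card ≤ 1)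
    (S : Finset (Fin m)) (hS : (symmDiff S B).card ≤ 1) : ∃ j, u j = S := by
  classical
  set T : Finset (Finset (Fin m)) := insert B (Finset.univ.image fun a : Fin m => symmDiff B {a})
    with hT
  have hmemT : ∀ S : Finset (Fin m), (symmDiff S B).card ≤ 1 → S ∈ T := by
    intro S hS
    rcases eq_or_eq_symmDiff_singleton_of_card_le_one B S hS with rfl | ⟨a, rfl⟩
    · exact Finset.mem_insert_self _ _
    · exact Finset.mem_insert_of_mem (Finset.mem_image.mpr ⟨a, Finset.mem_univ _, rfl⟩)
  have hsub : Finset.univ.image u ⊆ T := by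
    intro S hS
    obtain ⟨j, -, rfl⟩ := Finset.mem_image.mp hS
    exact hmemT _ (hstar j)
  have hcard : T.card ≤ (Finset.univ.image u).card := by
    rw [Finset.card_image_of_injective _ hu, Finset.card_univ, Fintype.card_fin]
    exact (card_ball_le m B).trans hr
  have heq := Finset.eq_of_subset_of_card_le hsub hcard
  have hST : S ∈ Finset.univ.image u := by
    rw [heq]
    exact hmemT S hS
  obtain ⟨j, -, hj⟩ := Finset.mem_image.mp hST
  exact ⟨j, hj⟩

/-- **A star family of distinct subsets of `Fin m` has at most — hence, if `r ≥ m + 1`, exactly —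
`m + 1` members.** -/
theorem card_eq_of_star {m r : ℕ} (u : Fin r → Finset (Fin m)) (hu : Function.Injective u)
    (hr : m + 1 ≤ r) (B : Finset (Fin m)) (hstar : ∀ j, (symmDiff (u j) B).card ≤ 1) :
    r = m + 1 := by
  classical
  have hsub : Finset.univ.image u ⊆ insert B (Finset.univ.image fun a : Fin m => symmDiff B {a}) := by
    intro S hS
    obtain ⟨j, -, rfl⟩ := Finset.mem_image.mp hS
    rcases eq_or_eq_symmDiff_singleton_of_card_le_one B (u j) (hstar j) with h | ⟨a, h⟩
    · rw [h]
      exact Finset.mem_insert_self _ _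
    · rw [h]
      exact Finset.mem_insert_of_mem (Finset.mem_image.mpr ⟨a, Finset.mem_univ _, rfl⟩)
  have := (Finset.card_le_card hsub).trans (card_ball_le m B)
  rw [Finset.card_image_of_injective _ hu, Finset.card_univ, Fintype.card_fin] at this
  omega

/-- In a star family exhausting the ball, a coordinate of the centre has degree `r - 1` and a
coordinate off the centre has degree `1`; in particular **every degree is `1` or `r - 1`**. -/
theorem degree_eq_of_star {m r : ℕ} (u : Fin r → Finset (Fin m)) (hu : Function.Injective u)
    (hr : m + 1 ≤ r) (B : Finset (Fin m)) (hstar : ∀ j, (symmDiff (u j) B).card ≤ 1) (a : Fin m) :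
    (Finset.univ.filter fun i => a ∈ u i).card = if a ∈ B then r - 1 else 1 := by
  classical
  -- the unique index of the member `B ∆ {a}`, and of the member `B`
  obtain ⟨ja, hja⟩ := exists_index_eq_of_star u hu hr B hstar (symmDiff B {a})
    (by rw [symmDiff_comm B, symmDiff_symmDiff_cancel_right]; simp)
  have hmem : ∀ i, a ∈ u i ↔ ((a ∈ B) ↔ i ≠ ja) := by
    intro i
    rcases eq_or_eq_symmDiff_singleton_of_card_le_one B (u i) (hstar i) with h | ⟨b, h⟩
    · have hi : i ≠ ja := by
        rintro rfl
        rw [hja] at h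
        have : a ∈ symmDiff B {a} ↔ a ∈ B := by rw [h]
        rw [Finset.mem_symmDiff] at this
        simp at this
      rw [h]
      tauto
    · by_cases hb : b = a
      · subst hb
        have hi : i = ja := hu (h.trans hja.symm)
        rw [h, Finset.mem_symmDiff]
        simp [hi]
      · have hi : i ≠ ja := by
          rintro rfl
          rw [hja] at h
          have hb' : b ∈ symmDiff B {a} ↔ b ∈ symmDiff B {b} := by rw [h]
          simp [Finset.mem_symmDiff, hb] at hb'
        rw [h, Finset.mem_symmDiff]
        have hab : a ≠ b := fun e => hb e.symm
        simp [hab, hi]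
  by_cases haB : a ∈ B
  · rw [if_pos haB]
    have : (Finset.univ.filter fun i => a ∈ u i) = Finset.univ.erase ja := by
      ext i
      simp [hmem i, haB]
    rw [this, Finset.card_erase_of_mem (Finset.mem_univ _), Finset.card_univ, Fintype.card_fin]
  · rw [if_neg haB]
    have : (Finset.univ.filter fun i => a ∈ u i) = {ja} := by
      ext i
      simp [hmem i, haB]
    rw [this, Finset.card_singleton]

/-! ## 5. Locked pairs of height `4` and size `5` -/

/-- In a LOCKED pair no row degree equals a column degree, and no row degree and column degree add
up to `r` (the literal classes `a ∈ u i` versus `c ∈ w j` and versus `c ∉ w j`). -/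
theorem degree_ne_and_add_ne_of_locked {m r : ℕ} (u w : Fin r → Finset (Fin m))
    (hlk : ∀ (a c : Fin m) (β γ : Bool),
      (Finset.univ.filter fun i => (a ∈ u i ↔ β = true)).card ≠
        (Finset.univ.filter fun j => (c ∈ w j ↔ γ = true)).card)
    (a c : Fin m) :
    (Finset.univ.filter fun i => a ∈ u i).card ≠ (Finset.univ.filter fun j => c ∈ w j).card ∧
      (Finset.univ.filter fun i => a ∈ u i).card + (Finset.univ.filter fun j => c ∈ w j).card ≠ r := by
  have h1 := hlk a c true true
  have h2 := hlk a c true false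
  simp only [iff_true, Bool.false_eq_true, iff_false] at h1 h2
  have h3 := degree_add_codegree w c
  omega

/-- **STRUCTURE OF LOCKED PAIRS OF HEIGHT `4` AND SIZE `5`.**  If `u, w : Fin 5 → Finset (Fin 4)`
are injective and the pair is locked, then EITHER every row degree avoids `{1, 4}` and the columns
form a star (all at distance `≤ 1` from a centre `B`), OR every column degree avoids `{1, 4}` and the
rows form a star.  Decide-free replacement for the family enumerations of the size-`5` plan; the
star side exhausts its ball (`exists_index_eq_of_star`) and has degrees in `{1, 4}`
(`degree_eq_of_star`). -/
theorem locked_star_classification (u w : Fin 5 → Finset (Fin 4)) (hu : Function.Injective u)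
    (hw : Function.Injective w)
    (hlk : ∀ (a c : Fin 4) (β γ : Bool),
      (Finset.univ.filter fun i => (a ∈ u i ↔ β = true)).card ≠
        (Finset.univ.filter fun j => (c ∈ w j ↔ γ = true)).card) :
    ((∀ a : Fin 4, (Finset.univ.filter fun i => a ∈ u i).card ≠ 1 ∧
        (Finset.univ.filter fun i => a ∈ u i).card ≠ 4) ∧
      ∃ B : Finset (Fin 4), ∀ j, (symmDiff (w j) B).card ≤ 1) ∨
    ((∀ c : Fin 4, (Finset.univ.filter fun j => c ∈ w j).card ≠ 1 ∧
        (Finset.univ.filter fun j => c ∈ w j).card ≠ 4) ∧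
      ∃ B : Finset (Fin 4), ∀ i, (symmDiff (u i) B).card ≤ 1) := by
  have hne := degree_ne_and_add_ne_of_locked u w hlk
  obtain ⟨c, hc0, hc5⟩ := exists_degree_strict w hw (by norm_num)
  by_cases hc : (Finset.univ.filter fun j => c ∈ w j).card = 1 ∨
      (Finset.univ.filter fun j => c ∈ w j).card = 4
  · -- a column degree in `{1, 4}`: rows avoid `{1, 4}`, a strict row degree is `2` or `3`,
    -- so the columns avoid `{2, 3}` and form a star
    left
    have hrows : ∀ a : Fin 4, (Finset.univ.filter fun i => a ∈ u i).card ≠ 1 ∧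
        (Finset.univ.filter fun i => a ∈ u i).card ≠ 4 := fun a => by
      have := hne a c
      omega
    refine ⟨hrows, exists_center_of_degrees w hw (by norm_num) fun c' => ?_⟩
    obtain ⟨a, ha0, ha5⟩ := exists_degree_strict u hu (by norm_num)
    have h1 := hrows a
    have h2 := hne a c'
    omega
  · -- a column degree in `{2, 3}`: rows avoid `{2, 3}` and form a star; a strict row degree is
    -- `1` or `4`, so the columns avoid `{1, 4}`
    right
    have hrows : ∀ a : Fin 4, (Finset.univ.filter fun i => a ∈ u i).card ≤ 1 ∨
        5 ≤ (Finset.univ.filter fun i => a ∈ u i).card + 1 := fun a => by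
      have := hne a c
      omega
    refine ⟨fun c' => ?_, exists_center_of_degrees u hu (by norm_num) hrows⟩
    obtain ⟨a, ha0, ha5⟩ := exists_degree_strict u hu (by norm_num)
    have h1 := hrows a
    have h2 := hne a c'
    omega

end Summit.ValiantsHypothesis.ValiantsHypothesis.Theorems.BarrierLever.ChowFactor
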